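import Literature.AlgebraicGeometry.Smoothening.JacobianCriterion
import Literature.AlgebraicGeometry.Smoothening.SmoothAtTransport
import Mathlib.RingTheory.Localization.LocalizationLocalization
import HarnessLib

/-!
# The smooth chart attached to a maximal minor of the Jacobian

Topic: `Literature/AlgebraicGeometry/Smoothening` (the construction in the proof of
Bosch–Lütkebohmert–Raynaud, *Néron Models*, Lemma 3.3/1 ⟹; Görtz–Wedhorn I, Def. 6.14). Let
`B = R[T₁, …, Tₙ]`, `I ⊆ B` an ideal, `A = B/I` (`X = Spec A`), and `f₁, …, f_c ∈ I` with a
choice `a` of `c` columns and the minor `Δ = det (∂f_j/∂T_{a i})`. The **chart**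
`C = (B/(f))[1/Δ]` is standard smooth over `R` of relative dimension `n - c`
(`JacobianCriterion`), and `X ∩ D(Δ) = Spec A[1/Δ_A]` is a closed subscheme of `Z = Spec C`:

* `toQuotient` — the surjection `D = B/(f) → A`; `minorImage` — `Δ_A`, the image of `Δ` in `A`;
* `Chart f a ha = C`, `ALoc = A[1/Δ_A]`; `chartToALoc` — **the surjection `C → A[1/Δ_A]`**
  (`chartToALoc_surjective`); `chartKer = J`, its kernel, and
  `chartQuotEquiv : C/J ≃ₐ[R] A[1/Δ_A]`;
* `isSmoothAt_aLoc_iff` — `A[1/Δ_A]` is smooth over `R` at a prime iff `A` is smooth at its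
  contraction (the local rings agree);
* `isSmoothAt_chartQuot_iff` — the same for `C/J` through `chartQuotEquiv`;
* `isLocalization_atPrime_aLoc` — the local ring of `A[1/Δ_A]` at a prime is the local ring of
  `A` at its contraction.

Folklore bookkeeping around Mathlib's localization API; no named facts (D-0026).

## References

* U. Görtz, T. Wedhorn, *Algebraic Geometry I: Schemes*, 2nd ed. (2020), Def. 6.14 (p. 159).
  [GortzWedhorn2020]
* S. Bosch, W. Lütkebohmert, M. Raynaud, *Néron Models*, Springer 1990, Lemma 3.3/1.
  [BLRNeronModels1990] (Not held; number only.)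
-/

noncomputable section

open MvPolynomial

namespace Literature.AlgebraicGeometry.Smoothening

universe u

variable {R : Type u} [CommRing R] {n c : ℕ} (I : Ideal (MvPolynomial (Fin n) R))
  (f : Fin c → MvPolynomial (Fin n) R) (hf : ∀ i, f i ∈ I) (a : Fin c → Fin n)
  (ha : Function.Injective a)

include hf in
/-- `(f₁, …, f_c) ⊆ I`. [folklore] -/
theorem span_range_le : Ideal.span (Set.range f) ≤ I :=
  Ideal.span_le.mpr (by rintro _ ⟨i, rfl⟩; exact hf i)

/-- **The surjection `D = B/(f) → A = B/I`.** [folklore] -/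
def toQuotient : Quot f →ₐ[R] MvPolynomial (Fin n) R ⧸ I :=
  Ideal.Quotient.factorₐ R (span_range_le I f hf)

/-- `D → A` on classes of polynomials. [folklore] -/
theorem toQuotient_mk (x : MvPolynomial (Fin n) R) :
    toQuotient I f hf (Ideal.Quotient.mk _ x) = Ideal.Quotient.mk I x :=
  rfl

/-- `D → A` is surjective. [folklore] -/
theorem toQuotient_surjective : Function.Surjective (toQuotient I f hf) := by
  intro y
  obtain ⟨x, rfl⟩ := Ideal.Quotient.mk_surjective y
  exact ⟨Ideal.Quotient.mk _ x, rfl⟩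

/-- **`Δ_A`**: the image in `A` of the Jacobian minor `Δ`. [cite: GortzWedhorn2020, Def. 6.14 (p. 159)] -/
abbrev minorImage : MvPolynomial (Fin n) R ⧸ I :=
  toQuotient I f hf (jacobianMinor f a ha)

/-- `Δ_A` is the class of the determinant `det (∂f_j/∂T_{a i})`. [folklore] -/
theorem minorImage_eq_mk :
    minorImage I f hf a ha =
      Ideal.Quotient.mk I (Matrix.det (Matrix.of fun i j : Fin c => (f j).pderiv (a i))) := by
  rw [minorImage, jacobianMinor_eq_mk_det]
  rfl

/-- **The chart `C = (B/(f))[1/Δ]`** (standard smooth of relative dimension `n - c`,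
`isStandardSmoothOfRelativeDimension_away`). [cite: GortzWedhorn2020, Def. 6.14 (p. 159)] -/
abbrev Chart : Type u := Localization.Away (jacobianMinor f a ha)

/-- **`A[1/Δ_A]`**, the coordinate ring of `X ∩ D(Δ)`. [folklore] -/
abbrev ALoc : Type u := Localization.Away (minorImage I f hf a ha)

/-- **The surjection `C = (B/(f))[1/Δ] → A[1/Δ_A]`** induced by `B/(f) → A`. [folklore] -/
def chartToALoc : Chart f a ha →ₐ[R] ALoc I f hf a ha :=
  IsLocalization.Away.mapₐ (Chart f a ha) (ALoc I f hf a ha) (toQuotient I f hf)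
    (jacobianMinor f a ha)

/-- `C → A[1/Δ_A]` is surjective. [folklore] -/
theorem chartToALoc_surjective : Function.Surjective (chartToALoc I f hf a ha) := by
  unfold chartToALoc
  exact IsLocalization.Away.mapₐ_surjective_of_surjective (Aₚ := Chart f a ha)
    (Bₚ := ALoc I f hf a ha) (jacobianMinor f a ha) (toQuotient_surjective I f hf)

/-- `C → A[1/Δ_A]` is compatible with `D → A`. [folklore] -/
theorem chartToALoc_algebraMap (d : Quot f) :
    chartToALoc I f hf a ha (algebraMap (Quot f) (Chart f a ha) d) =
      algebraMap _ (ALoc I f hf a ha) (toQuotient I f hf d) := by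
  rw [chartToALoc, IsLocalization.Away.mapₐ_apply, IsLocalization.Away.map, IsLocalization.map_eq]
  rfl

/-- **`J`**, the kernel of `C → A[1/Δ_A]` (the ideal of `X ∩ D(Δ)` in the chart `Z = Spec C`). [folklore] -/
def chartKer : Ideal (Chart f a ha) :=
  RingHom.ker (chartToALoc I f hf a ha)

/-- **`C/J ≅ A[1/Δ_A]` over `R`.** [folklore] -/
def chartQuotEquiv : (Chart f a ha ⧸ chartKer I f hf a ha) ≃ₐ[R] ALoc I f hf a ha :=
  Ideal.quotientKerAlgEquivOfSurjective (chartToALoc_surjective I f hf a ha)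

/-! ### Smoothness and local rings along `A → A[1/Δ_A]` and `C/J ≅ A[1/Δ_A]` -/

/-- `A[1/Δ_A]` is smooth over `R` at a prime iff `A` is smooth at its contraction. [folklore] -/
theorem isSmoothAt_aLoc_iff (P : Ideal (ALoc I f hf a ha)) [P.IsPrime] :
    Algebra.IsSmoothAt R P ↔
      Algebra.IsSmoothAt R (P.comap (algebraMap (MvPolynomial (Fin n) R ⧸ I) (ALoc I f hf a ha))) :=
  isSmoothAt_iff_of_isLocalization_away R _ _ (minorImage I f hf a ha) P

/-- `C/J` is smooth over `R` at a prime iff `A` is smooth at the corresponding prime (through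
`C/J ≅ A[1/Δ_A]` and `A → A[1/Δ_A]`). [folklore] -/
theorem isSmoothAt_chartQuot_iff (P : Ideal (ALoc I f hf a ha)) [P.IsPrime] :
    Algebra.IsSmoothAt R (P.comap (chartQuotEquiv I f hf a ha).toRingEquiv.toRingHom) ↔
      Algebra.IsSmoothAt R (P.comap (algebraMap (MvPolynomial (Fin n) R ⧸ I) (ALoc I f hf a ha))) :=
  (isSmoothAt_comap_algEquiv_iff R (chartQuotEquiv I f hf a ha) P).trans (isSmoothAt_aLoc_iff I f hf a ha P)

/-- **The local ring of `A[1/Δ_A]` at a prime is the local ring of `A` at its contraction.** [folklore] -/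
theorem isLocalization_atPrime_aLoc (P : Ideal (ALoc I f hf a ha)) [P.IsPrime] :
    IsLocalization.AtPrime (Localization.AtPrime P)
      (P.comap (algebraMap (MvPolynomial (Fin n) R ⧸ I) (ALoc I f hf a ha))) :=
  IsLocalization.isLocalization_isLocalization_atPrime_isLocalization
    (Submonoid.powers (minorImage I f hf a ha)) _ P

/-- The chart is smooth over `R`. [cite: GortzWedhorn2020, Def. 6.14 (p. 159)] -/
theorem formallySmooth_chart : Algebra.FormallySmooth R (Chart f a ha) :=
  haveI := smooth_away f a ha (Chart f a ha)
  inferInstance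

end Literature.AlgebraicGeometry.Smoothening

end
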